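import Literature.NumberTheory.Weil1965.ThetaIntegralOrbitFunctionalUnitary
import Literature.NumberTheory.Automorphic.AdelicVectorPlaceSplittingLinear
import Literature.NumberTheory.Automorphic.UnitaryGroupPlaceInclusion
import Literature.NumberTheory.Automorphic.UnitaryGroupRestrictedProduct
import HarnessLib

/-!
# The geometric action of a `v`-member of the unitary dual pair is local at `v`: `A_{ι_v u}` fixes `X□(𝔸_F)^{(v)}`
# and acts through the place splitting `X□(𝔸_F) = X□(F_v) × X□(𝔸_F)^{(v)}` as `A_{u,v} × id`

Topic `NumberTheory/Weil1965`; namespace `Literature.NumberTheory.Weil1965.UnitaryDoubling` (sequel of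
`ThetaIntegralOrbitFunctionalUnitary`: `toHermVec`, `vDiagAct`, `toHermVec_vDiagAct`).  KERNEL ONLY: theorems; no definition,
no named fact, no instance, no `sorry`.

Setting of ★ `ThetaIntegralOrbitFunctionalUnitary` §2–§3: `E/F` a CM-type quadratic extension of number fields (`c δ = -δ`,
`δ² = d`), the unitary dual pair `(U(J_V), U(J_W))` with `J_W` of rank one, `X□(𝔸_F) = 𝔸_F^{n+n}` (`n = N · 1`), the geometric
action `A_h = vDiagAct h` of `h ∈ U(J_V)(𝔸_F)` and the `𝔸_E`-coordinates `toHermVec : X□(𝔸_F) → 𝔸_E^{N×1}` in which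
`A_h` is the matrix `h ⊗ 1` (`toHermVec_vDiagAct`).  For a finite place `v` of `F` and `u ∈ U(J_V)(F_v)` (the tree's
`UnitaryGroup.localPi E c N J_V v`), `ι_v u := UnitaryGroup.inclPlaceAdelic v u ∈ U(J_V)(𝔸_F)` is the element with component
`u` at `v` and `1` elsewhere (★ `UnitaryGroupPlaceInclusion`).

* §1 `toHermVec_smul` — the coordinates are `(· ⊗ 1)`-SEMILINEAR: `toHermVec (a • x) = (a ⊗ 1) • toHermVec x` for `a ∈ 𝔸_F`
  (★ `quadraticAdeleMap_smul`); `toHermVec_injective`.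
* §2 `baseChange_smul_coe_inclPlaceAdelic` — with the idempotent `e_v = adeleSingleHom F v 1 ∈ 𝔸_F` of the factor `F_v`:
  `((1 - e_v) ⊗ 1) • M(ι_v u) = ((1 - e_v) ⊗ 1) • 1` in `M_N(𝔸_E)` (the matrix of `ι_v u` is the identity at infinity and at
  every finite place of `E` not above `v` — ★ `map_fst_ofFinite`, `map_snd_ofFinite`, `evalAt_inclPlace_of_not_over` — while
  `(1 - e_v) ⊗ 1` vanishes above `v`).
* §3 **`vDiagAct_inclPlaceAdelic_apply_of_mem`** — `A_{ι_v u} y = y` for every `y ∈ X□(𝔸_F)^{(v)} := AdelicVector.trivialAt`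
  (the vectors with vanishing `v`-components): `A_{ι_v u}` is `𝔸_F`-linear, `y = (1 - e_v) • y`, and
  `(1 - e_v) • A_{ι_v u} x = (1 - e_v) • x` by §1–§2 (`one_sub_adeleSingleHom_smul_vDiagAct_inclPlaceAdelic`).  This is the ONE
  locality clause of ★ `AdelicVector.placeSplitting_symm_linearMap_of_forall_mem`.
* §4 consequences through the place splitting `Φ = AdelicVector.placeSplitting F (Fin (n+n)) v`:
  **`placeSplitting_symm_vDiagAct_inclPlaceAdelic`** (`Φ⁻¹ (A_{ι_v u} x) = (A_{u,v} x_v, (Φ⁻¹ x).2)` with the LOCAL OPERATOR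
  `A_{u,v} a := (A_{ι_v u} (single a))_v`), `continuous_evalAt_vDiagAct_single`, and the INVARIANCE TRANSPORT
  **`map_prodMap_map_placeSplitting_symm_vDiagAct`**: a measure on `X□(𝔸_F)` invariant under `A_{ι_v u}` transports along `Φ⁻¹` to
  a measure on `X□(F_v) × X□(𝔸_F)^{(v)}` invariant under `A_{u,v} × id`.

This is Weil's «`X_A = X_v × X′` … les `μ_i` sont invariantes par `G′`» step (A. Weil, *Acta Math.* 113 (1965), Chap. V
n° 50, pp. 73–74) for the `v`-member of the dual pair: the GROUP side of the binder (SPLIT-v ∘ BRIDGE-v) of the I-CLOSE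
assembly.  The identification of `A_{u,v}` with `(g_w, g_w⁻ᵀ)` after the split-place coordinates `β_v` (Weil n° 50:
`U(V)(F_v) ≅ GL_N(F_v)` at a place split in `E`) is the local half (`QuadraticHermitianNormSplitForm`,
`exists_gl_split_intertwine`) and is assembled downstream.

## References
* [Weil1965] A. Weil, *Sur la formule de Siegel dans la théorie des groupes classiques*, Acta Math. 113 (1965), Chap. V
  n° 50, pp. 73–74.
* [GelbartRogawski1991] S. Gelbart, J. Rogawski, Invent. Math. 105 (1991), §3.1 p. 454 (the embedding `ι`, coordinates).
* [PlatonovRapinchuk1994] V. Platonov, A. Rapinchuk, *Algebraic Groups and Number Theory* (1994), §5.1 (the coordinate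
  embeddings `G_{F_v} → G_𝔸`).
* [CasselsFrohlichANT1967] J. W. S. Cassels, A. Fröhlich, *Algebraic Number Theory* (1967), Ch. II §14 (the factor `K_v` of
  the adele ring and its idempotent).

USE (cell `hodgecm-mathlib`, FLOOR-0 P4, ENGINE E-2 child `Cruxes/H413/Lines/F0_E2SiegelWeilWeilRange.lean`, `StubSW2` (iii),
outer assembly `Theorems/H413E2SWIdentityClose`, binder (SPLIT-v ∘ BRIDGE-v), intertwining ∕ (INV) clauses).  HC_CM is proved
only modulo the printed citations until rung 0 closes.
-/

set_option autoImplicit false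

noncomputable section

namespace Literature.NumberTheory.Weil1965.UnitaryDoubling

open scoped Matrix Kronecker
open _root_.MeasureTheory NumberField IsDedekindDomain
open Literature.RepresentationTheory.HeisenbergGroup
open Literature.RepresentationTheory.HeisenbergGroup.SymplecticMatrix
open Literature.NumberTheory.Weil1964 Literature.NumberTheory.Weil1965 Literature.NumberTheory.Automorphic
open Literature.NumberTheory.GelbartRogawski1991 Literature.NumberTheory.GelbartRogawski1991.UnitaryDualPair
open Literature.NumberTheory.Automorphic.UnitaryGroup (reindexW reindexW_apply reindexW_symm_apply quadraticAdeleEquiv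
  quadraticAdeleEquiv_apply quadraticAdeleMap_smul adelicVal adelicVal_finAdelicToAdelic map_fst_ofFinite map_snd_ofFinite
  adeleFst adeleSnd PlacesOver localPi inclPlace inclPlaceAdelic inclPlaceAdelic_apply evalAt_inclPlace_of_not_over)
open Literature.NumberTheory.Automorphic.UnitaryGroup.QuadraticCoordinates
open Literature.NumberTheory.Automorphic.AdelicVector (evalAt single trivialAt placeSplitting)

section Local

variable (F E : Type) [Field F] [NumberField F] [Field E] [NumberField E] [Algebra F E] [Algebra.IsQuadraticExtension F E]
  (c : E ≃ₐ[F] E) {δ : E} (hcδ : c δ = -δ) (hδ : δ ≠ 0) {d : F} (hd : δ * δ = algebraMap F E d)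
  (N : ℕ) {n : ℕ} (e : Fin N × Fin 1 ≃ Fin n)
  (TV : Matrix (Fin N) (Fin N) F) (hV : TV.IsSymm) (hVd : IsUnit TV.det)
  (TW : Matrix (Fin 1) (Fin 1) F) (hW : TW.IsSymm) (hWd : IsUnit TW.det)

/-! ## §1 `toHermVec` is `(· ⊗ 1)`-semilinear and injective -/

/-- **`toHermVec (a • x) = (a ⊗ 1) • toHermVec x`** for `a ∈ 𝔸_F`: the `𝔸_E`-coordinates are `𝔸_F`-semilinear along the
base change `a ↦ a ⊗ 1` (the Darboux map and the reindexing are `𝔸_F`-linear, `Ψ_𝔸` is `(· ⊗ 1)`-semilinear: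
★ `quadraticAdeleMap_smul`). [cite: Weil1965, Chap. V n° 50, pp. 73–74] -/
theorem toHermVec_smul (a : AdeleRing (𝓞 F) F) (x : Fin (n + n) → AdeleRing (𝓞 F) F) :
    toHermVec F E c hcδ hδ N e TV hVd TW hWd (a • x) =
      AdeleRing.baseChange F E a • toHermVec F E c hcδ hδ N e TV hVd TW hWd x := by
  have hcomp : (a • x) ∘ ⇑finSumFinEquiv = a • (x ∘ ⇑finSumFinEquiv) := rfl
  unfold toHermVec
  rw [hcomp, LinearEquiv.map_smul, LinearEquiv.map_smul]
  set W := (reindexW (AdeleRing (𝓞 F) F) e).symm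
    ((darboux (adelicGram F e TV TW) (isUnit_det_adelicGram F e hVd hWd)).symm (x ∘ ⇑finSumFinEquiv)) with hW
  funext p
  exact quadraticAdeleMap_smul E _ a (W.1 p, W.2 p)

/-- `toHermVec` is injective (a composite of bijections). [cite: GelbartRogawski1991, §3.1 p. 454] -/
theorem toHermVec_injective : Function.Injective (toHermVec F E c hcδ hδ N e TV hVd TW hWd) := by
  intro x y hxy
  have h1 := congrArg (fun z => darboux (adelicGram F e TV TW) (isUnit_det_adelicGram F e hVd hWd)
    (reindexW (AdeleRing (𝓞 F) F) e (reIm (quadraticAdeleEquiv F E c hcδ hδ).toAddEquiv (Fin N × Fin 1) z))) hxy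
  simp only [toHermVec, AddEquiv.apply_symm_apply, LinearEquiv.apply_symm_apply] at h1
  funext i
  have := congrFun h1 (finSumFinEquiv.symm i)
  simpa using this

/-! ## §2 The matrix of a `v`-supported element is the identity away from `v` -/

/-- components of a difference of adeles at a finite place (definitional). [folklore] -/
private theorem adeleF_snd_sub_apply (x y : AdeleRing (𝓞 F) F) (w : HeightOneSpectrum (𝓞 F)) :
    (x - y).2 w = x.2 w - y.2 w := rfl

/-- archimedean part of a product of adeles of `E` (definitional). [folklore] -/
private theorem adeleE_fst_mul (x y : AdeleRing (𝓞 E) E) : (x * y).1 = x.1 * y.1 := rfl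

omit [Algebra.IsQuadraticExtension F E] in
/-- `(1 - e_v) ⊗ 1` vanishes at every place of `E` above `v`. [cite: CasselsFrohlichANT1967, Ch. II §14] -/
theorem baseChange_one_sub_adeleSingleHom_apply_of_over (v : HeightOneSpectrum (𝓞 F)) (w : HeightOneSpectrum (𝓞 E))
    (hw : w.under (𝓞 F) = v) :
    (AdeleRing.baseChange F E (1 - adeleSingleHom F v 1)).2 w = 0 := by
  subst hw
  rw [AdeleRing.baseChange_snd, FiniteAdeleRing.baseChange_apply, adeleF_snd_sub_apply, adeleSingleHom_apply_snd,
    finiteAdeleSingleHom_apply_self]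
  change adicCompletionOfUnder (𝓞 F) F E w ((1 : FiniteAdeleRing (𝓞 F) F) (w.under (𝓞 F)) - 1) = 0
  have h1 : (1 : FiniteAdeleRing (𝓞 F) F) (w.under (𝓞 F)) = 1 := rfl
  rw [h1, sub_self, map_zero]

omit [Algebra.IsQuadraticExtension F E] in
/-- **Away from `v` the matrix of `inclPlaceAdelic v u` is the identity, at `v` the scalar `(1 - e_v) ⊗ 1` vanishes**:
`((1 - e_v) ⊗ 1) • M(inclPlaceAdelic v u) = ((1 - e_v) ⊗ 1) • 1` in `M_N(𝔸_E)`. [cite: PlatonovRapinchuk1994, §5.1] -/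
theorem baseChange_smul_coe_inclPlaceAdelic (v : HeightOneSpectrum (𝓞 F)) (J : Matrix (Fin N) (Fin N) E)
    (u : localPi E c N J v) :
    AdeleRing.baseChange F E (1 - adeleSingleHom F v 1) •
        (adelicVal F E c N J (inclPlaceAdelic F E c N J v u)).val =
      AdeleRing.baseChange F E (1 - adeleSingleHom F v 1) • (1 : Matrix (Fin N) (Fin N) (AdeleRing (𝓞 E) E)) := by
  set s := AdeleRing.baseChange F E (1 - adeleSingleHom F v 1) with hs
  have hM : adelicVal F E c N J (inclPlaceAdelic F E c N J v u) = GLn.ofFinite N E (inclPlace F E c N J v u).1 := by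
    rw [inclPlaceAdelic_apply, adelicVal_finAdelicToAdelic]
  rw [hM]
  have hfst := map_fst_ofFinite E N (inclPlace F E c N J v u).1
  have hsnd := map_snd_ofFinite E N (inclPlace F E c N J v u).1
  ext i j
  rw [Matrix.smul_apply, Matrix.smul_apply, smul_eq_mul, smul_eq_mul]
  refine Prod.ext ?_ (RestrictedProduct.ext _ _ fun w => ?_)
  · -- archimedean parts: the matrix of `ofFinite g` is `1` at infinity
    rw [adeleE_fst_mul, adeleE_fst_mul]
    have h1 : ((GLn.ofFinite N E (inclPlace F E c N J v u).1).val i j).1 = (1 : Matrix (Fin N) (Fin N) (InfiniteAdeleRing E)) i j := by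
      have := congrFun (congrFun hfst i) j
      rwa [Matrix.map_apply] at this
    have h2 : ((1 : Matrix (Fin N) (Fin N) (AdeleRing (𝓞 E) E)) i j).1 = (1 : Matrix (Fin N) (Fin N) (InfiniteAdeleRing E)) i j := by
      rw [Matrix.one_apply, Matrix.one_apply]
      split_ifs <;> rfl
    rw [h1, h2]
  · -- finite components, read through the ring homomorphism `adeleEval E w : 𝔸_E →+* E_w`
    change AdelicGroupData.adeleEval E w (s * (GLn.ofFinite N E (inclPlace F E c N J v u).1).val i j) =
      AdelicGroupData.adeleEval E w (s * (1 : Matrix (Fin N) (Fin N) (AdeleRing (𝓞 E) E)) i j)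
    rw [map_mul, map_mul]
    by_cases hwv : w.under (𝓞 F) = v
    · have h0 : AdelicGroupData.adeleEval E w s = 0 := baseChange_one_sub_adeleSingleHom_apply_of_over F E v w hwv
      rw [h0, zero_mul, zero_mul]
    · have hw1 : (GLn.ofFinite N E (inclPlace F E c N J v u).1).val.map (AdelicGroupData.adeleEval E w) =
          (1 : Matrix (Fin N) (Fin N) (w.adicCompletion E)) := by
        have h4 : ((inclPlace F E c N J v u).1.val).map (AdelicGroupData.finiteAdeleEval E w) =
            (1 : Matrix (Fin N) (Fin N) (w.adicCompletion E)) :=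
          congrArg (fun g : GL (Fin N) (w.adicCompletion E) => (g : Matrix (Fin N) (Fin N) (w.adicCompletion E)))
            (evalAt_inclPlace_of_not_over F E c N J hwv u ⟨w, rfl⟩)
        calc (GLn.ofFinite N E (inclPlace F E c N J v u).1).val.map (AdelicGroupData.adeleEval E w)
            = ((GLn.ofFinite N E (inclPlace F E c N J v u).1).val.map (adeleSnd E)).map
                (AdelicGroupData.finiteAdeleEval E w) := by rw [Matrix.map_map]; rfl
          _ = ((inclPlace F E c N J v u).1.val).map (AdelicGroupData.finiteAdeleEval E w) := by rw [hsnd]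
          _ = 1 := h4
      have h5 : AdelicGroupData.adeleEval E w ((GLn.ofFinite N E (inclPlace F E c N J v u).1).val i j) =
          (1 : Matrix (Fin N) (Fin N) (w.adicCompletion E)) i j := by
        have := congrFun (congrFun hw1 i) j
        rwa [Matrix.map_apply] at this
      rw [h5, adeleEval_one_apply N E w i j]

/-! ## §3 The geometric action of a `v`-supported element fixes the vectors trivial at `v` -/

/-- `(1 - e_v) • y = y` for `y` trivial at `v`. [cite: CasselsFrohlichANT1967, Ch. II §14] -/
theorem one_sub_adeleSingleHom_smul_of_mem {v : HeightOneSpectrum (𝓞 F)} {y : Fin (n + n) → AdeleRing (𝓞 F) F}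
    (hy : y ∈ trivialAt F (Fin (n + n)) v) : (1 - adeleSingleHom F v 1) • y = y := by
  rw [sub_smul, one_smul, AdelicVector.adeleSingleHom_one_smul_eq_zero_of_mem hy, sub_zero]

/-- **The `v`-member acts on the factor `X_v` only**: for `u ∈ U(J_V)(F_v)` embedded at `v` and every `x ∈ X□(𝔸_F)`,
`(1 - e_v) • A_{ι_v u} x = (1 - e_v) • x` — in `𝔸_E`-coordinates `A_{ι_v u}` is the matrix `ι_v(u) ⊗ 1`, which is the
identity away from `v` (Weil (1965) n° 50: «les μ_i sont invariantes par G′ … X_A = X_v × X′»).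
[cite: Weil1965, Chap. V n° 50, pp. 73–74] -/
theorem one_sub_adeleSingleHom_smul_vDiagAct_inclPlaceAdelic (v : HeightOneSpectrum (𝓞 F))
    (u : localPi E c N (TV.map (algebraMap F E)) v) (x : Fin (n + n) → AdeleRing (𝓞 F) F) :
    (1 - adeleSingleHom F v 1) • vDiagAct F E c hcδ hδ hd N e TV hV hVd TW hW hWd
        (inclPlaceAdelic F E c N (TV.map (algebraMap F E)) v u) x =
      (1 - adeleSingleHom F v 1) • x := by
  apply toHermVec_injective F E c hcδ hδ N e TV hVd TW hWd
  rw [toHermVec_smul, toHermVec_vDiagAct, toHermVec_smul, UnitaryGroup.coe_adelicInl, ← Matrix.smul_mulVec,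
    ← Matrix.smul_kronecker, ← UnitaryGroup.adelicVal_apply,
    baseChange_smul_coe_inclPlaceAdelic F E c N v (TV.map (algebraMap F E)) u, Matrix.smul_kronecker,
    Matrix.one_kronecker_one, Matrix.smul_mulVec, Matrix.one_mulVec]

/-- **The geometric action of a `v`-supported element fixes `X□(𝔸_F)^{(v)}` pointwise**: `A_{ι_v u} y = y` for every
`y` trivial at `v` — the ONE locality clause of ★ `AdelicVector.placeSplitting_symm_linearMap_of_forall_mem`.
[cite: Weil1965, Chap. V n° 50, pp. 73–74] -/
theorem vDiagAct_inclPlaceAdelic_apply_of_mem (v : HeightOneSpectrum (𝓞 F))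
    (u : localPi E c N (TV.map (algebraMap F E)) v) {y : Fin (n + n) → AdeleRing (𝓞 F) F}
    (hy : y ∈ trivialAt F (Fin (n + n)) v) :
    vDiagAct F E c hcδ hδ hd N e TV hV hVd TW hW hWd (inclPlaceAdelic F E c N (TV.map (algebraMap F E)) v u) y = y := by
  set L := vDiagAct F E c hcδ hδ hd N e TV hV hVd TW hW hWd (inclPlaceAdelic F E c N (TV.map (algebraMap F E)) v u) with hL
  calc L y = L ((1 - adeleSingleHom F v 1) • y) := by rw [one_sub_adeleSingleHom_smul_of_mem F hy]
    _ = (1 - adeleSingleHom F v 1) • L y := LinearEquiv.map_smul L _ _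
    _ = (1 - adeleSingleHom F v 1) • y :=
        one_sub_adeleSingleHom_smul_vDiagAct_inclPlaceAdelic F E c hcδ hδ hd N e TV hV hVd TW hW hWd v u y
    _ = y := one_sub_adeleSingleHom_smul_of_mem F hy

/-! ## §4 Through the place splitting: `A_{ι_v u} = A_{u,v} × id` on `X□(F_v) × X□(𝔸_F)^{(v)}` -/

/-- **Through the splitting `X□(𝔸_F) = X□(F_v) × X□(𝔸_F)^{(v)}` the `v`-member acts as `A_{u,v} × id`** with the local
operator `A_{u,v} a := (A_{ι_v u} (single a))_v` (★ `AdelicVector.placeSplitting_symm_linearMap_of_forall_mem`).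
[cite: Weil1965, Chap. V n° 50, pp. 73–74] -/
theorem placeSplitting_symm_vDiagAct_inclPlaceAdelic (v : HeightOneSpectrum (𝓞 F))
    (u : localPi E c N (TV.map (algebraMap F E)) v) (x : Fin (n + n) → AdeleRing (𝓞 F) F) :
    (placeSplitting F (Fin (n + n)) v).symm
        (vDiagAct F E c hcδ hδ hd N e TV hV hVd TW hW hWd (inclPlaceAdelic F E c N (TV.map (algebraMap F E)) v u) x) =
      (evalAt F (Fin (n + n)) v (vDiagAct F E c hcδ hδ hd N e TV hV hVd TW hW hWd
          (inclPlaceAdelic F E c N (TV.map (algebraMap F E)) v u) (single F (Fin (n + n)) v (evalAt F (Fin (n + n)) v x))),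
        ((placeSplitting F (Fin (n + n)) v).symm x).2) :=
  AdelicVector.placeSplitting_symm_linearMap_of_forall_mem
    (vDiagAct F E c hcδ hδ hd N e TV hV hVd TW hW hWd (inclPlaceAdelic F E c N (TV.map (algebraMap F E)) v u)).toLinearMap
    (fun _ hy => vDiagAct_inclPlaceAdelic_apply_of_mem F E c hcδ hδ hd N e TV hV hVd TW hW hWd v u hy) x

/-- **The local operator `A_{u,v}`** `a ↦ (A_{ι_v u} (single a))_v` is continuous (`single`, the `𝔸_F`-linear `A`, `evalAt`).
[cite: Weil1965, Chap. V n° 50, pp. 73–74] -/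
theorem continuous_evalAt_vDiagAct_single (v : HeightOneSpectrum (𝓞 F)) (h : UnitaryGroup.adelic F E c N (TV.map (algebraMap F E))) :
    Continuous fun a : Fin (n + n) → v.adicCompletion F =>
      evalAt F (Fin (n + n)) v (vDiagAct F E c hcδ hδ hd N e TV hV hVd TW hW hWd h (single F (Fin (n + n)) v a)) := by
  have hL : Continuous (vDiagAct F E c hcδ hδ hd N e TV hV hVd TW hW hWd h :
      (Fin (n + n) → AdeleRing (𝓞 F) F) → (Fin (n + n) → AdeleRing (𝓞 F) F)) := by
    haveI : ContinuousSMul (AdeleRing (𝓞 F) F) (AdeleRing (𝓞 F) F) := ⟨continuous_mul⟩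
    exact (vDiagAct F E c hcδ hδ hd N e TV hV hVd TW hW hWd h).toLinearMap.continuous_on_pi
  exact (AdelicVector.continuous_evalAt F (Fin (n + n)) v).comp
    (hL.comp (AdelicVector.continuous_single F (Fin (n + n)) v))

/-- **INVARIANCE TRANSPORT for the `v`-member**: a measure `μ` on `X□(𝔸_F)` invariant under `A_{ι_v u}` transports along
the place splitting to a measure invariant under `A_{u,v} × id` (Weil (1965) n° 50: the fibre measures read on `X_v × X′`
are invariant under the `v`-member). [cite: Weil1965, Chap. V n° 50, pp. 73–74] -/
theorem map_prodMap_map_placeSplitting_symm_vDiagAct (v : HeightOneSpectrum (𝓞 F))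
    [MeasurableSpace (AdeleRing (𝓞 F) F)] [BorelSpace (AdeleRing (𝓞 F) F)]
    [MeasurableSpace (v.adicCompletion F)] [BorelSpace (v.adicCompletion F)]
    (u : localPi E c N (TV.map (algebraMap F E)) v) (μ : Measure (Fin (n + n) → AdeleRing (𝓞 F) F))
    (hμ : Measure.map (vDiagAct F E c hcδ hδ hd N e TV hV hVd TW hW hWd (inclPlaceAdelic F E c N (TV.map (algebraMap F E)) v u)) μ = μ) :
    Measure.map (Prod.map (fun a : Fin (n + n) → v.adicCompletion F =>
        evalAt F (Fin (n + n)) v (vDiagAct F E c hcδ hδ hd N e TV hV hVd TW hW hWd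
          (inclPlaceAdelic F E c N (TV.map (algebraMap F E)) v u) (single F (Fin (n + n)) v a))) id)
        (Measure.map (placeSplitting F (Fin (n + n)) v).symm μ) =
      Measure.map (placeSplitting F (Fin (n + n)) v).symm μ := by
  haveI := secondCountableTopology_adicCompletion F v
  haveI := AdelicVector.secondCountableTopology_piLocal F (Fin (n + n)) v
  haveI : BorelSpace (Fin (n + n) → v.adicCompletion F) := Pi.borelSpace
  exact AdelicVector.map_prodMap_map_placeSplitting_symm
    (vDiagAct F E c hcδ hδ hd N e TV hV hVd TW hW hWd (inclPlaceAdelic F E c N (TV.map (algebraMap F E)) v u)).toLinearMap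
    (fun _ hy => vDiagAct_inclPlaceAdelic_apply_of_mem F E c hcδ hδ hd N e TV hV hVd TW hW hWd v u hy) _
    (continuous_evalAt_vDiagAct_single F E c hcδ hδ hd N e TV hV hVd TW hW hWd v _).measurable (fun _ => rfl) μ hμ

end Local

end Literature.NumberTheory.Weil1965.UnitaryDoubling
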